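import Literature.Computability.QuantumComplexity.ForrelationThm25Amplitude
import Literature.Computability.Complexity.PromiseProofs
import HarnessLib

/-!
# Aaronson–Ambainis Theorem 25: the instance map QSIM → explicit `k`-fold FORRELATION

Topic `Literature/Computability/QuantumComplexity`; third file of the decomposition of the named
fact `aaronson_ambainis_kForrelation_complete` (`ForrelationComplete.lean`), after
`ForrelationCompleteProofs.lean` (QSIM, the gadget, the steps as named facts) and
`ForrelationThm25Amplitude.lean` (the amplitude identity `Φ = A_Q`, proved with the parity
repair). Source: S. Aaronson, A. Ambainis, *Forrelation*, SIAM J. Comput. 47 (2018) =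
arXiv:1411.5729, §6, Thm. 25 (pp. 26–27 of the arXiv version).

## What is proved

The reduction of Theorem 25 as an explicit map on instances and its correctness, leaving only
its polynomial-time computability (a Turing-machine programming statement) as a named fact:

* `FewBits N`: the syntax of the functions produced by the reduction (`1`, `(-1)^{z_p z_d}`,
  `(-1)^{z_a z_b z_c}`), their semantics `FewBits.toFun` and their `B₂`-circuits
  `FewBits.toCircuit` (at most two binary AND gates; `eval_toCircuit`, `toCircuit_isOver_B2`);
* `forrBuildD`, `forrBuildPaddedD`: the syntactic translation of a `{H, CCSIGN}` circuit, with
  `forrBuild = map toFun ∘ forrBuildD` (`forrBuild_eq_map_forrBuildD`), so that all of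
  `ForrelationThm25Amplitude.lean` applies;
* `compress`: discarding the untouched wires (`n_c ≤ 3m` remain for an `m`-gate circuit,
  `card_touchedWires_le_three_mul_size`; `transitionAmplitude_compress : A` unchanged) — needed
  because the code of an instance writes `n` in binary, so that the `O(n)` padding of the parity
  repair would not be polynomial in the input length; whence also the printed `k = O(m)`:
  `AaronsonAmbainis2018_thm25_amplitude_linear` (`N ≤ 3m + 2`, `k ≤ 16m + 6`);
* `thm25Instance : QSimInstance → KForrelationInstance` (compress, add `n_c mod 2` idle wires,
  then the plain or the padded translation of the amplitude file according to the parity of the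
  number of Hadamard gates; instances with oracle gates, outside the promise, go to the empty
  instance) with **`(thm25Instance I).value = A_Q`** (`value_thm25Instance`), whence yes ↦ yes
  and no ↦ no (`isYes_thm25Instance`, `isNo_thm25Instance`; the thresholds `3/5`, `1/100` of
  QSIM and of FORRELATION coincide), all circuits over `B₂`, `N ≤ 3m + 2`, `k ≤ 16m + 6`,
  `≤ 2` gates each;
* the assembly `AaronsonAmbainis2018_thm25_of_encodeFP`: if the string map
  `code(I) ↦ code(thm25Instance I)` is in `FP` (named fact `AaronsonAmbainis2018_thm25_encodeFP`,
  the residual `TM2` statement; its output has `O(ℓ log ℓ)` bits on inputs of length `ℓ`), then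
  QSIM `≤ₚ` explicit `k`-fold FORRELATION (`AaronsonAmbainis2018_thm25` of
  `ForrelationCompleteProofs.lean`); and `aaronson_ambainis_kForrelation_complete_of_encodeFP`:
  the completeness fact from the three residual named facts (membership, Lemma 24 hardness,
  `encodeFP`), transitivity of promise reductions being the library's
  `PolyTimeReducible.trans_holds`.

## References

* S. Aaronson, A. Ambainis, *Forrelation: a problem that optimally separates quantum from
  classical computing*, SIAM J. Comput. 47 (2018) 982–1038; arXiv:1411.5729, §6, Thm. 25
  (statement: "the functions f₁,…,f_k produced by the reduction all have the form
  fᵢ(x) = (-1)^{C(x)}, where C is a product of at most 3 input bits"; proof, pp. 26–27).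
* O. Goldreich, *On promise problems: a survey*, 2006, Def. 1.4 (Karp reductions of promise
  problems).
* S. Arora, B. Barak, *Computational Complexity*, CUP 2009, Def. 6.1 (Boolean circuits).
-/

noncomputable section

namespace Literature.Computability.QuantumComplexity

open Matrix _root_.Computability Complexity Cryptography Finset

variable {N n : ℕ}

/-! ### The syntax of the produced functions and their `B₂`-circuits -/

/-- The shapes of the functions `fᵢ = (-1)^{C}` produced by the reduction of Thm. 25: `C = 0`
(`f = 1`), `C = z_p z_d`, or `C = z_a z_b z_c`. [cite: AaronsonAmbainis2018, §6 Thm. 25 ("C is a product of at most 3 input bits")] -/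
inductive FewBits (N : ℕ)
  /-- `C = 0`, i.e. `f = 1`. -/
  | one
  /-- `C = z_p z_d`. -/
  | two (p d : Fin N)
  /-- `C = z_a z_b z_c`. -/
  | three (a b c : Fin N)

namespace FewBits

/-- The Boolean function `C` of a shape (so that `f = (-1)^C`, read through `signOf`).
[cite: AaronsonAmbainis2018, §6 Thm. 25] -/
def toFun : FewBits N → (Fin N → Bool) → Bool
  | one => fun _ => false
  | two p d => csignFun p d
  | three a b c => fun z => z a && (z b && z c)

/-- The one binary AND gate circuit `z_p ∧ z_d`. [cite: AroraBarak2009, Def. 6.1] -/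
def and2Circuit (p d : Fin N) : Circuit (Fin N) where
  gates := [⟨2, fun v => v 0 && v 1, ![.inl p, .inl d]⟩]
  output := .inr 0
  wf j h := by
    simp only [List.length_singleton, Nat.lt_one_iff] at h
    subst h
    show ∀ (i : Fin 2) (m : ℕ), (![Sum.inl p, Sum.inl d] : Fin 2 → Fin N ⊕ ℕ) i = .inr m → m < 0
    intro i m hm
    fin_cases i <;> simp at hm
  wf_output m h := by cases h; simp

/-- The two-gate circuit `z_a ∧ (z_b ∧ z_c)` (binary AND gates). [cite: AroraBarak2009, Def. 6.1] -/
def and3Circuit (a b c : Fin N) : Circuit (Fin N) where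
  gates := [⟨2, fun v => v 0 && v 1, ![.inl b, .inl c]⟩, ⟨2, fun v => v 0 && v 1, ![.inl a, .inr 0]⟩]
  output := .inr 1
  wf j h := by
    have hj : j = 0 ∨ j = 1 := by
      simp only [List.length_cons, List.length_nil] at h
      omega
    rcases hj with rfl | rfl
    · show ∀ (i : Fin 2) (m : ℕ), (![Sum.inl b, Sum.inl c] : Fin 2 → Fin N ⊕ ℕ) i = .inr m → m < 0
      intro i m hm
      fin_cases i <;> simp at hm
    · show ∀ (i : Fin 2) (m : ℕ), (![Sum.inl a, Sum.inr 0] : Fin 2 → Fin N ⊕ ℕ) i = .inr m → m < 1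
      intro i m hm
      fin_cases i
      · simp at hm
      · simp only [Fin.mk_one, Matrix.cons_val_one, Matrix.cons_val_fin_one, Sum.inr.injEq] at hm
        omega
  wf_output m h := by cases h; simp

/-- The `B₂`-circuit of a shape: the constant circuit, one AND gate, or two AND gates.
[cite: AaronsonAmbainis2018, §6 Thm. 25 ("so will be easy to specify using a Boolean circuit")] -/
def toCircuit : FewBits N → Circuit (Fin N)
  | one => Circuit.const (Fin N) false
  | two p d => and2Circuit p d
  | three a b c => and3Circuit a b c

/-- The circuit of a shape computes its Boolean function. [cite: AaronsonAmbainis2018, §6 Thm. 25] -/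
theorem eval_toCircuit (s : FewBits N) (x : Fin N → Bool) : s.toCircuit.eval x = s.toFun x := by
  cases s with
  | one => rfl
  | two p d => rfl
  | three a b c => rfl

/-- As functions: the circuit of a shape computes its Boolean function. [cite: AaronsonAmbainis2018, §6 Thm. 25] -/
theorem eval_toCircuit_eq (s : FewBits N) : s.toCircuit.eval = s.toFun :=
  funext (eval_toCircuit s)

/-- The circuits of the shapes are over `B₂` (fan-in `≤ 2`). [cite: AaronsonAmbainis2018, §6 Thm. 25] -/
theorem toCircuit_isOver_B2 (s : FewBits N) : s.toCircuit.IsOver B2 := by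
  intro g hg
  cases s with
  | one =>
    simp only [toCircuit, Circuit.const, List.mem_singleton] at hg
    subst hg
    show (0 : ℕ) ≤ 2
    norm_num
  | two p d =>
    simp only [toCircuit, and2Circuit, List.mem_singleton] at hg
    subst hg
    exact le_refl 2
  | three a b c =>
    simp only [toCircuit, and3Circuit, List.mem_cons, List.not_mem_nil, or_false] at hg
    rcases hg with rfl | rfl <;> exact le_refl 2

/-- The circuits of the shapes have at most two gates. [cite: AaronsonAmbainis2018, §6 Thm. 25] -/
theorem size_toCircuit_le (s : FewBits N) : s.toCircuit.size ≤ 2 := by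
  cases s <;> simp [toCircuit, and2Circuit, and3Circuit, Circuit.size, Circuit.const]

/-- Every shape is a few-bit product in the sense of `IsFewBitProduct` (for `two`, when the two
wires differ; `two p p` is the single bit `z_p`). [cite: AaronsonAmbainis2018, §6 Thm. 25] -/
theorem isFewBitProduct_toFun (s : FewBits N) : IsFewBitProduct s.toFun := by
  cases s with
  | one => exact isFewBitProduct_const_false N
  | two p d =>
    by_cases h : p = d
    · subst h
      exact ⟨{p}, by simp, fun z => by simp [toFun, csignFun]⟩
    · exact isFewBitProduct_csignFun p d h
  | three a b c => exact ⟨{a, b, c}, Finset.card_le_three, fun z => by simp [toFun]⟩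

end FewBits

/-! ### The syntactic translation -/

/-- The block of shapes simulating one gate (cf. `forrGateBlock`). [cite: AaronsonAmbainis2018, §6 (proof of Thm. 25)] -/
def forrGateBlockD (σ : WireConfig n N) : QGate hCCSign n → List (FewBits N)
  | .gate HCCSignOp.H e =>
      [.two (σ.pos (hPlacement e 0)) σ.dum, .two (σ.pos (hPlacement e 0)) σ.dum, .two (σ.pos (hPlacement e 0)) σ.dum]
  | .gate HCCSignOp.CCSIGN e =>
      [.one, .three (σ.pos (ccsignPlacement e 0)) (σ.pos (ccsignPlacement e 1)) (σ.pos (ccsignPlacement e 2)), .one]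
  | .oracle _ _ => [.one, .one, .one]

/-- The syntactic translation of a gate list (cf. `forrBuild`). [cite: AaronsonAmbainis2018, §6 (proof of Thm. 25)] -/
def forrBuildD : List (QGate hCCSign n) → WireConfig n N → List (FewBits N)
  | [], _ => [.one]
  | g :: gs, σ => forrGateBlockD σ g ++ .one :: forrBuildD gs (forrGateStep σ g)

/-- The translation `forrBuild` is the semantics of the syntactic translation `forrBuildD`.
[cite: AaronsonAmbainis2018, §6 (proof of Thm. 25)] -/
theorem forrBuild_eq_map_forrBuildD (gs : List (QGate hCCSign n)) (σ : WireConfig n N) :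
    forrBuild gs σ = (forrBuildD gs σ).map FewBits.toFun := by
  induction gs generalizing σ with
  | nil => rfl
  | cons g gs ih =>
    rcases g with ⟨_ | _, e⟩ | ⟨m, e⟩ <;>
      simp only [forrBuild, forrBuildD, forrGateBlock, forrGateBlockD, forrGateStep, List.map_append, List.map_cons,
        List.map_nil, ih] <;> rfl

/-- The syntactic padded translation (cf. `forrBuildPadded`). [cite: AaronsonAmbainis2018, §6 (proof of Thm. 25)] -/
def forrBuildPaddedD (gs : List (QGate hCCSign n)) (σ : WireConfig n N) : List (FewBits N) :=
  forrBuildD (gs ++ hOnAllWires n) σ ++ [.one]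

/-- `forrBuildPadded` is the semantics of `forrBuildPaddedD`. [cite: AaronsonAmbainis2018, §6 (proof of Thm. 25)] -/
theorem forrBuildPadded_eq_map_forrBuildPaddedD (gs : List (QGate hCCSign n)) (σ : WireConfig n N) :
    forrBuildPadded gs σ = (forrBuildPaddedD gs σ).map FewBits.toFun := by
  rw [forrBuildPadded, forrBuildPaddedD, List.map_append, forrBuild_eq_map_forrBuildD]
  rfl

/-- A circuit on `n` wires regarded as a circuit on `n + t` wires (the last `t` wires idle).
[folklore] -/
def liftCircuitBy {G : QGateSet} : (t : ℕ) → QCircuit G n → QCircuit G (n + t)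
  | 0, C => C
  | t + 1, C => liftCircuitSucc (liftCircuitBy t C)

/-- Idle wires do not change the size. [folklore] -/
@[simp] theorem size_liftCircuitBy {G : QGateSet} (t : ℕ) (C : QCircuit G n) : (liftCircuitBy t C).size = C.size := by
  induction t with
  | zero => rfl
  | succ t ih => rw [liftCircuitBy, size_liftCircuitSucc, ih]

/-- Idle wires preserve oracle-freeness. [folklore] -/
theorem isOracleFree_liftCircuitBy {G : QGateSet} (t : ℕ) {C : QCircuit G n} (hC : C.IsOracleFree) :
    (liftCircuitBy t C).IsOracleFree := by
  induction t with
  | zero => exact hC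
  | succ t ih => exact isOracleFree_liftCircuitSucc ih

/-- Idle wires do not change the number of Hadamard gates. [folklore] -/
theorem hadamardCount_liftCircuitBy (t : ℕ) (Q : QCircuit hCCSign n) : hadamardCount (liftCircuitBy t Q).gates = hadamardCount Q.gates := by
  induction t with
  | zero => rfl
  | succ t ih => rw [liftCircuitBy, liftCircuitSucc, hadamardCount_liftCircuitSucc, ih]

/-- Idle wires do not change the transition amplitude. [cite: AaronsonAmbainis2018, §6] -/
theorem transitionAmplitude_liftCircuitBy (t : ℕ) (Q : QCircuit hCCSign n) :
    transitionAmplitude (liftCircuitBy t Q) = transitionAmplitude Q := by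
  induction t with
  | zero => rfl
  | succ t ih => rw [liftCircuitBy, transitionAmplitude_liftCircuitSucc, ih]

/-- `n + (n mod 2)` is even (the number of logical wires after adding `n mod 2` idle wires;
from Mathlib's `Nat.even_iff` / `Nat.odd_iff`). [folklore] -/
theorem even_add_mod_two (n : ℕ) : Even (n + n % 2) := by
  rcases Nat.even_or_odd n with h | h
  · rw [Nat.even_iff.1 h, add_zero]
    exact h
  · rw [Nat.odd_iff.1 h]
    exact h.add_one

/-- **The shapes produced by the reduction**, on `N = n + (n mod 2) + 1` bits: after `n mod 2`
idle wires (so that the number of logical wires is even), the plain translation if the number of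
Hadamard gates is even and the padded translation otherwise.
[cite: AaronsonAmbainis2018, §6 (proof of Thm. 25)] -/
def thm25Shapes (n : ℕ) (Q : QCircuit hCCSign n) : List (FewBits (n + n % 2 + 1)) :=
  if Even (hadamardCount Q.gates) then forrBuildD (liftCircuitBy (n % 2) Q).gates (WireConfig.init (n + n % 2))
  else forrBuildPaddedD (liftCircuitBy (n % 2) Q).gates (WireConfig.init (n + n % 2))

/-- The reduction uses at most `n + 2` bits. [cite: AaronsonAmbainis2018, §6 Thm. 25] -/
theorem thm25_bits_le (n : ℕ) : n + n % 2 + 1 ≤ n + 2 := by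
  have := Nat.mod_lt n two_pos
  omega

/-- The reduction produces at most `4(m + n + 1) + 2` functions. [cite: AaronsonAmbainis2018, §6 Thm. 25 ("k = O(m)"; here O(m + n))] -/
theorem length_thm25Shapes_le (n : ℕ) (Q : QCircuit hCCSign n) :
    (thm25Shapes n Q).length ≤ 4 * (Q.size + n + 1) + 2 := by
  have hmod := Nat.mod_lt n two_pos
  unfold thm25Shapes
  split_ifs
  · have h := length_forrBuild (liftCircuitBy (n % 2) Q).gates (WireConfig.init (n + n % 2))
    rw [forrBuild_eq_map_forrBuildD, List.length_map] at h
    rw [h]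
    change 4 * (liftCircuitBy (n % 2) Q).size + 1 ≤ _
    rw [size_liftCircuitBy]
    omega
  · have h := length_forrBuildPadded (liftCircuitBy (n % 2) Q).gates (WireConfig.init (n + n % 2))
    rw [forrBuildPadded_eq_map_forrBuildPaddedD, List.length_map] at h
    rw [h]
    change 4 * ((liftCircuitBy (n % 2) Q).size + (n + n % 2)) + 2 ≤ _
    rw [size_liftCircuitBy]
    omega

/-- **The produced functions have `Φ = A_Q`**: the `⟨0…0|·|0…0⟩` entry of the Fig. 2 circuit of
the produced functions is `A_Q` (by the parity cases of `ForrelationThm25Amplitude.lean`).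
[cite: AaronsonAmbainis2018, §6 (proof of Thm. 25)] -/
theorem forrelationCircuitL_thm25Shapes (n : ℕ) (Q : QCircuit hCCSign n) (hQ : Q.IsOracleFree) :
    forrelationCircuitL ((thm25Shapes n Q).map FewBits.toFun) (fun _ => false) (fun _ => false) =
      (transitionAmplitude Q : ℂ) := by
  rw [← transitionAmplitude_liftCircuitBy (n % 2) Q, transitionAmplitude_coe]
  unfold thm25Shapes
  split_ifs with h
  · rw [← forrBuild_eq_map_forrBuildD, forrBuild_apply_zero_zero_of_even (liftCircuitBy (n % 2) Q)
      (isOracleFree_liftCircuitBy _ hQ) _ (by rwa [hadamardCount_liftCircuitBy])]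
  · rw [← forrBuildPadded_eq_map_forrBuildPaddedD, forrBuildPadded_apply_zero_zero (liftCircuitBy (n % 2) Q)
      (isOracleFree_liftCircuitBy _ hQ)]
    rw [hadamardCount_liftCircuitBy, add_assoc]
    exact (Nat.not_even_iff_odd.1 h).add_odd ((even_add_mod_two n).add_one)

/-! ### Discarding the untouched wires

The code of a QSIM instance writes `n` in binary, so a polynomial-time reduction may only spend
`poly(m, log n)` on an `m`-gate circuit; the parity repair of the amplitude file, however, costs
`O(n)` functions. Wires not touched by any gate contribute the factor `⟨0|I|0⟩ = 1` to `A_Q` and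
are discarded first: `compress Q` relabels the `n_c ≤ 3m` touched wires by their rank. -/

/-- A gate on `n'` wires transported along a wire embedding `ι : Fin n' ↪ Fin n`. [folklore] -/
def mapWiresGate {G : QGateSet} {n' n : ℕ} (ι : Fin n' ↪ Fin n) : QGate G n' → QGate G n
  | .gate g e => .gate g (e.trans ι)
  | .oracle m e => .oracle m (e.trans ι)

/-- The transported gate acts as the original gate placed along `ι`. [cite: NielsenChuang2010, §4.2] -/
theorem toMatrix_mapWiresGate {G : QGateSet} {n' n : ℕ} (ι : Fin n' ↪ Fin n) (A : Language Bool)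
    (g : QGate G n') : (mapWiresGate ι g).toMatrix A = placeGate ι (g.toMatrix A) := by
  cases g with
  | gate g e => rw [mapWiresGate, QGate.toMatrix_gate, QGate.toMatrix_gate, placeGate_placeGate]
  | oracle m e => rw [mapWiresGate, QGate.toMatrix_oracle, QGate.toMatrix_oracle, placeGate_placeGate]

/-- A circuit on `n'` wires transported along a wire embedding `ι : Fin n' ↪ Fin n`. [folklore] -/
def mapWires {G : QGateSet} {n' n : ℕ} (ι : Fin n' ↪ Fin n) (C : QCircuit G n') : QCircuit G n :=
  ⟨C.gates.map (mapWiresGate ι)⟩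

/-- The transported circuit acts as the original circuit placed along `ι`. [cite: NielsenChuang2010, §4.2] -/
theorem toMatrix_mapWires {G : QGateSet} {n' n : ℕ} (ι : Fin n' ↪ Fin n) (A : Language Bool)
    (C : QCircuit G n') : (mapWires ι C).toMatrix A = placeGate ι (C.toMatrix A) := by
  obtain ⟨gs⟩ := C
  induction gs with
  | nil => simp [mapWires]
  | cons g gs ih =>
    have ih' : (⟨gs.map (mapWiresGate ι)⟩ : QCircuit G n).toMatrix A =
        placeGate ι ((⟨gs⟩ : QCircuit G n').toMatrix A) := ih
    change (⟨mapWiresGate ι g :: gs.map (mapWiresGate ι)⟩ : QCircuit G n).toMatrix A = _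
    rw [QCircuit.toMatrix_cons, ih', toMatrix_mapWiresGate, QCircuit.toMatrix_cons, placeGate_mul_holds]

/-- **Transporting along a wire embedding preserves the transition amplitude**:
`⟨0ⁿ| Q placed along ι |0ⁿ⟩ = ⟨0^{n'}|Q|0^{n'}⟩` (the other wires stay in `|0⟩`).
[cite: AaronsonAmbainis2018, §6 (A_Q)] -/
theorem transitionAmplitude_mapWires {n' n : ℕ} (ι : Fin n' ↪ Fin n) (Q : QCircuit hCCSign n') :
    transitionAmplitude (mapWires ι Q) = transitionAmplitude Q := by
  unfold transitionAmplitude QCircuit.mat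
  rw [toMatrix_mapWires, placeGate_apply, if_pos fun _ _ => rfl]
  rfl

/-- The wires touched by a gate list. [folklore] -/
def touchedWires {G : QGateSet} : List (QGate G n) → Finset (Fin n)
  | [] => ∅
  | g :: gs => g.wires ∪ touchedWires gs

/-- Every gate of the list acts within the touched wires. [folklore] -/
theorem wires_subset_touchedWires {G : QGateSet} {gs : List (QGate G n)} {g : QGate G n} (hg : g ∈ gs) :
    g.wires ⊆ touchedWires gs := by
  induction gs with
  | nil => cases hg
  | cons g' gs ih =>
    rcases List.mem_cons.1 hg with rfl | h
    · exact Finset.subset_union_left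
    · exact (ih h).trans Finset.subset_union_right

/-- There are at most `n` touched wires. [folklore] -/
theorem card_touchedWires_le {G : QGateSet} (gs : List (QGate G n)) : (touchedWires gs).card ≤ n :=
  (Finset.card_le_univ _).trans_eq (Fintype.card_fin n)

/-- An `m`-gate circuit over `{H, CCSIGN}` touches at most `3m` wires. [cite: AaronsonAmbainis2018, §6] -/
theorem card_touchedWires_le_three_mul (gs : List (QGate hCCSign n)) (hgs : ∀ g ∈ gs, g.IsOracleFree) :
    (touchedWires gs).card ≤ 3 * gs.length := by
  induction gs with
  | nil => simp [touchedWires]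
  | cons g gs ih =>
    have hg : g.wires.card ≤ 3 := by
      rcases g with ⟨_ | _, e⟩ | ⟨m, e⟩
      · change (Finset.univ.map (hPlacement e)).card ≤ 3
        rw [Finset.card_map, Finset.card_univ, Fintype.card_fin]
        norm_num
      · change (Finset.univ.map (ccsignPlacement e)).card ≤ 3
        rw [Finset.card_map, Finset.card_univ, Fintype.card_fin]
      · exact absurd (hgs _ List.mem_cons_self) id
    calc (touchedWires (g :: gs)).card ≤ g.wires.card + (touchedWires gs).card :=
          Finset.card_union_le _ _
      _ ≤ 3 + 3 * gs.length := Nat.add_le_add hg (ih fun g' h => hgs g' (by simp [h]))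
      _ = 3 * (g :: gs).length := by rw [List.length_cons]; ring

/-- The rank of a wire of `T` in `T` (its relabelling after discarding the other wires). [folklore] -/
def rankIn (T : Finset (Fin n)) (i : Fin n) (hi : i ∈ T) : Fin T.card :=
  (T.orderIsoOfFin rfl).symm ⟨i, hi⟩

/-- Enumerating `T` increasingly inverts the rank. [folklore] -/
theorem orderEmbOfFin_rankIn (T : Finset (Fin n)) (i : Fin n) (hi : i ∈ T) :
    T.orderEmbOfFin rfl (rankIn T i hi) = i := by
  change (((T.orderIsoOfFin rfl) ((T.orderIsoOfFin rfl).symm ⟨i, hi⟩) : T) : Fin n) = i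
  rw [OrderIso.apply_symm_apply]

/-- A wire embedding into `T`, relabelled by ranks. [folklore] -/
def compressEmb (T : Finset (Fin n)) {r : ℕ} (e : Fin r ↪ Fin n) (he : ∀ j, e j ∈ T) :
    Fin r ↪ Fin T.card :=
  ⟨fun j => rankIn T (e j) (he j), fun j j' h => e.injective (by
    have h' := congrArg (T.orderEmbOfFin rfl) h
    rwa [orderEmbOfFin_rankIn, orderEmbOfFin_rankIn] at h')⟩

/-- Relabelling by ranks and enumerating `T` gives back the embedding. [folklore] -/
theorem compressEmb_trans (T : Finset (Fin n)) {r : ℕ} (e : Fin r ↪ Fin n) (he : ∀ j, e j ∈ T) :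
    (compressEmb T e he).trans (T.orderEmbOfFin rfl).toEmbedding = e := by
  ext j
  exact congrArg Fin.val (orderEmbOfFin_rankIn T (e j) (he j))

/-- The wires of a placed gate are the values of its embedding. [folklore] -/
theorem apply_mem_wires_gate {G : QGateSet} (g : G.Op) (e : Fin (G.arity g) ↪ Fin n) (j : Fin (G.arity g)) :
    e j ∈ (QGate.gate g e : QGate G n).wires :=
  Finset.mem_map.2 ⟨j, Finset.mem_univ _, rfl⟩

/-- The wires of a placed oracle gate are the values of its embedding. [folklore] -/
theorem apply_mem_wires_oracle {G : QGateSet} (m : ℕ) (e : Fin (m + 1) ↪ Fin n) (j : Fin (m + 1)) :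
    e j ∈ (QGate.oracle m e : QGate G n).wires :=
  Finset.mem_map.2 ⟨j, Finset.mem_univ _, rfl⟩

/-- A gate acting within `T`, relabelled as a gate on `#T` wires. [folklore] -/
def compressGate {G : QGateSet} (T : Finset (Fin n)) : (g : QGate G n) → g.wires ⊆ T → QGate G T.card
  | .gate op e, h => .gate op (compressEmb T e fun j => h (apply_mem_wires_gate op e j))
  | .oracle m e, h => .oracle m (compressEmb T e fun j => h (apply_mem_wires_oracle m e j))

/-- Transporting the relabelled gate back along the enumeration of `T` gives the gate. [folklore] -/
theorem mapWiresGate_compressGate {G : QGateSet} (T : Finset (Fin n)) (g : QGate G n) (h : g.wires ⊆ T) :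
    mapWiresGate (T.orderEmbOfFin rfl).toEmbedding (compressGate T g h) = g := by
  cases g with
  | gate op e => simp only [compressGate, mapWiresGate, compressEmb_trans]
  | oracle m e => simp only [compressGate, mapWiresGate, compressEmb_trans]

/-- **Compression**: a circuit with its untouched wires discarded (the touched wires relabelled
by rank). [cite: AaronsonAmbainis2018, §6 (proof of Thm. 25)] -/
def compress {G : QGateSet} (C : QCircuit G n) : QCircuit G (touchedWires C.gates).card :=
  ⟨C.gates.pmap (compressGate (touchedWires C.gates)) fun _ hg => wires_subset_touchedWires hg⟩

/-- The compressed circuit, transported back along the enumeration of the touched wires, is the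
original circuit. [folklore] -/
theorem mapWires_compress {G : QGateSet} (C : QCircuit G n) :
    mapWires ((touchedWires C.gates).orderEmbOfFin rfl).toEmbedding (compress C) = C := by
  obtain ⟨gs⟩ := C
  change (⟨(gs.pmap (compressGate (touchedWires gs)) fun _ hg => wires_subset_touchedWires hg).map
    (mapWiresGate ((touchedWires gs).orderEmbOfFin rfl).toEmbedding)⟩ : QCircuit G n) = ⟨gs⟩
  rw [List.map_pmap]
  congr 1
  exact List.pmap_eq_self.2 fun g hg => mapWiresGate_compressGate _ g _

/-- Compression preserves the number of gates. [folklore] -/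
@[simp] theorem size_compress {G : QGateSet} (C : QCircuit G n) : (compress C).size = C.size :=
  List.length_pmap

/-- Compression preserves oracle-freeness. [folklore] -/
theorem isOracleFree_compress {G : QGateSet} {C : QCircuit G n} (hC : C.IsOracleFree) :
    (compress C).IsOracleFree := by
  intro g hg
  obtain ⟨g', hg', rfl⟩ := List.mem_pmap.1 hg
  have := hC g' hg'
  cases g' with
  | gate _ _ => trivial
  | oracle _ _ => exact absurd this id

/-- **Compression preserves the transition amplitude** (`A_Q` does not see untouched wires).
[cite: AaronsonAmbainis2018, §6 (A_Q)] -/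
theorem transitionAmplitude_compress (Q : QCircuit hCCSign n) :
    transitionAmplitude (compress Q) = transitionAmplitude Q := by
  conv_rhs => rw [← mapWires_compress Q]
  exact (transitionAmplitude_mapWires _ _).symm

/-- An oracle-free `{H, CCSIGN}` circuit compresses to at most `3m` wires. [cite: AaronsonAmbainis2018, §6] -/
theorem card_touchedWires_le_three_mul_size (Q : QCircuit hCCSign n) (hQ : Q.IsOracleFree) :
    (touchedWires Q.gates).card ≤ 3 * Q.size :=
  card_touchedWires_le_three_mul Q.gates hQ

/-- **AA Thm. 25, amplitude form with `k = O(m)` (as printed) on `O(m)` bits.** Discarding the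
untouched wires first, an oracle-free `m`-gate `{H, CCSIGN}` circuit has `Φ_{f₁,…,f_k} = A_Q` for
some `k ≤ 16m + 6` functions of the shape `IsFewBitProduct` on `N ≤ 3m + 2` bits (compare
`AaronsonAmbainis2018_thm25_amplitude_corrected`: `N ≤ n + 2`, `k = O(m + n)`).
[cite: AaronsonAmbainis2018, §6 Thm. 25 ("k = O(m)")] -/
theorem AaronsonAmbainis2018_thm25_amplitude_linear (n : ℕ) (Q : QCircuit hCCSign n)
    (hQ : Q.IsOracleFree) :
    ∃ (N k : ℕ) (f : Fin k → (Fin N → Bool) → Bool),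
      N ≤ 3 * Q.size + 2 ∧ k ≤ 16 * Q.size + 6 ∧ (∀ i, IsFewBitProduct (f i)) ∧
        kForrelationValue f = transitionAmplitude Q := by
  obtain ⟨N, k, f, hN, hk, hf, hval⟩ :=
    AaronsonAmbainis2018_thm25_amplitude_corrected _ (compress Q) (isOracleFree_compress hQ)
  have hc := card_touchedWires_le_three_mul_size Q hQ
  rw [size_compress] at hk
  refine ⟨N, k, f, by omega, ?_, hf, by rw [hval, transitionAmplitude_compress]⟩
  calc k ≤ 4 * (Q.size + (touchedWires Q.gates).card + 1) + 2 := hk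
    _ ≤ 4 * (Q.size + 3 * Q.size + 1) + 2 := by gcongr
    _ = 16 * Q.size + 6 := by ring

/-! ### The instance map and its correctness -/

/-- Tuples of a list read through a map: `ofFn (f ∘ L.get) = L.map f` (the pointwise-lambda
form of core's `List.map_ofFn` with `List.ofFn_get`, which `rw` needs here). [folklore] -/
theorem ofFn_get_comp {α β : Type*} (L : List α) (f : α → β) :
    List.ofFn (fun i => f (L.get i)) = L.map f := by
  apply List.ext_getElem <;> simp

/-- The number of touched wires of a QSIM instance. [folklore] -/
abbrev QSimInstance.wireCount (I : QSimInstance) : ℕ := (touchedWires I.circuit.gates).card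

/-- The empty explicit-Forrelation instance (no inputs, no circuits), the image of the instances
outside the promise (circuits with oracle gates). [folklore] -/
def KForrelationInstance.empty : KForrelationInstance := ⟨0, 0, Fin.elim0⟩

open scoped Classical in
/-- **The instance map of Theorem 25**: an oracle-free QSIM instance `(n, Q)` is compressed to
its `n_c ≤ 3m` touched wires and sent to the explicit Forrelation instance `(N, k, C₁, …, C_k)`
on `N = n_c + (n_c mod 2) + 1` bits with `Cᵢ` the `B₂`-circuit of the `i`-th produced shape;
instances outside the promise (oracle gates) go to the empty instance.
[cite: AaronsonAmbainis2018, §6 Thm. 25 (proof)] -/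
def thm25Instance (I : QSimInstance) : KForrelationInstance :=
  if I.circuit.IsOracleFree then
    { n := I.wireCount + I.wireCount % 2 + 1
      k := (thm25Shapes I.wireCount (compress I.circuit)).length
      C := fun i => ((thm25Shapes I.wireCount (compress I.circuit)).get i).toCircuit }
  else KForrelationInstance.empty

/-- The instance map on oracle-free instances (the `if` resolved). [cite: AaronsonAmbainis2018, §6 Thm. 25] -/
theorem thm25Instance_of_isOracleFree (I : QSimInstance) (hI : I.circuit.IsOracleFree) :
    thm25Instance I =
      { n := I.wireCount + I.wireCount % 2 + 1
        k := (thm25Shapes I.wireCount (compress I.circuit)).length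
        C := fun i => ((thm25Shapes I.wireCount (compress I.circuit)).get i).toCircuit } := by
  rw [thm25Instance, if_pos hI]

/-- The produced circuits are over `B₂`. [cite: AaronsonAmbainis2018, §6 Thm. 25] -/
theorem isOverB2_thm25Instance (I : QSimInstance) : (thm25Instance I).IsOverB2 := by
  unfold thm25Instance
  split_ifs
  · exact fun _ => FewBits.toCircuit_isOver_B2 _
  · exact fun i => i.elim0

/-- The produced instance has at most `n + 2` input bits. [cite: AaronsonAmbainis2018, §6 Thm. 25] -/
theorem n_thm25Instance_le (I : QSimInstance) : (thm25Instance I).n ≤ I.n + 2 := by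
  unfold thm25Instance
  split_ifs
  · have h1 := card_touchedWires_le I.circuit.gates
    have h2 := Nat.mod_lt (touchedWires I.circuit.gates).card two_pos
    change (touchedWires I.circuit.gates).card + (touchedWires I.circuit.gates).card % 2 + 1 ≤ I.n + 2
    omega
  · exact Nat.zero_le _

/-- **The produced instance has `O(m)` input bits**: at most `3m + 2` for an `m`-gate circuit
(the number `n` of qubits, written in binary in the code of the instance, does not enter).
[cite: AaronsonAmbainis2018, §6 Thm. 25] -/
theorem n_thm25Instance_le_size (I : QSimInstance) : (thm25Instance I).n ≤ 3 * I.circuit.size + 2 := by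
  unfold thm25Instance
  split_ifs with h
  · have h1 := card_touchedWires_le_three_mul_size I.circuit h
    have h2 := Nat.mod_lt (touchedWires I.circuit.gates).card two_pos
    change (touchedWires I.circuit.gates).card + (touchedWires I.circuit.gates).card % 2 + 1 ≤ _
    omega
  · exact Nat.zero_le _

/-- **The produced instance has `O(m)` circuits**: at most `16m + 6`. [cite: AaronsonAmbainis2018, §6 Thm. 25 ("k = O(m)")] -/
theorem k_thm25Instance_le (I : QSimInstance) : (thm25Instance I).k ≤ 16 * I.circuit.size + 6 := by
  unfold thm25Instance
  split_ifs with h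
  · have h1 := card_touchedWires_le_three_mul_size I.circuit h
    have h2 := length_thm25Shapes_le (touchedWires I.circuit.gates).card (compress I.circuit)
    rw [size_compress] at h2
    change (thm25Shapes (touchedWires I.circuit.gates).card (compress I.circuit)).length ≤ _
    calc _ ≤ 4 * (I.circuit.size + (touchedWires I.circuit.gates).card + 1) + 2 := h2
      _ ≤ 4 * (I.circuit.size + 3 * I.circuit.size + 1) + 2 := by gcongr
      _ = 16 * I.circuit.size + 6 := by ring
  · exact Nat.zero_le _

/-- Each produced circuit has at most two gates. [cite: AaronsonAmbainis2018, §6 Thm. 25] -/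
theorem size_C_thm25Instance_le (I : QSimInstance) :
    ∀ i : Fin (thm25Instance I).k, ((thm25Instance I).C i).size ≤ 2 := by
  by_cases h : I.circuit.IsOracleFree
  · rw [thm25Instance_of_isOracleFree I h]
    exact fun _ => FewBits.size_toCircuit_le _
  · rw [thm25Instance, if_neg h]
    exact fun i => i.elim0

/-- **Correctness of the instance map: `Φ(thm25Instance I) = A_Q`.**
[cite: AaronsonAmbainis2018, §6 Thm. 25 (proof: "such that Φ_{f₁,…,f_k} = A_Q")] -/
theorem value_thm25Instance (I : QSimInstance) (hI : I.circuit.IsOracleFree) :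
    (thm25Instance I).value = I.amplitude := by
  rw [thm25Instance_of_isOracleFree I hI]
  apply Complex.ofReal_injective
  unfold KForrelationInstance.value QSimInstance.amplitude
  simp only [FewBits.eval_toCircuit_eq]
  rw [← forrelationCircuit_apply_zero_zero, forrelationCircuit_eq_forrelationCircuitL, ofFn_get_comp,
    forrelationCircuitL_thm25Shapes _ _ (isOracleFree_compress hI), transitionAmplitude_compress]

/-- Yes-instances of QSIM go to yes-instances of explicit `k`-fold Forrelation (same threshold
`3/5`). [cite: AaronsonAmbainis2018, §6 Thm. 25] -/
theorem isYes_thm25Instance {I : QSimInstance} (h : I.IsYes) : (thm25Instance I).IsYes :=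
  ⟨isOverB2_thm25Instance I, by rw [value_thm25Instance I h.1]; exact h.2⟩

/-- No-instances of QSIM go to no-instances of explicit `k`-fold Forrelation (same threshold
`1/100`). [cite: AaronsonAmbainis2018, §6 Thm. 25] -/
theorem isNo_thm25Instance {I : QSimInstance} (h : I.IsNo) : (thm25Instance I).IsNo :=
  ⟨isOverB2_thm25Instance I, by rw [value_thm25Instance I h.1]; exact h.2⟩

/-! ### Assembly: Theorem 25 from the polynomial-time computability of the instance map -/

/-- NAMED FACT (**the residual Turing-machine content of AA Thm. 25**): the instance map of
Theorem 25, on codes — `code(n, Q) ↦ code(thm25Instance (n, Q))` (QSIM instances encoded by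
`QSimInstance.encode`, Forrelation instances by `KForrelationInstance.encode`) — is computed by
some function in `FP` (deterministic polynomial time, `TM2`): parse the code, collect and rank
the touched wires (`compress`), make one pass over the gate list (`forrBuildD`, with the padding
of the parity repair on the `n_c ≤ 3m` compressed wires only) and emit the circuits. Output size,
in terms of the input length `ℓ = |code(n, Q)| ≥ m` (`QCircuit.size_le_length_encode`; `n`
enters `code` in binary and the output not at all): `k ≤ 16m + 6` circuits
(`k_thm25Instance_le`) of `≤ 2` gates (`size_C_thm25Instance_le`) on `N ≤ 3m + 2` wires
(`n_thm25Instance_le_size`), each wire index written in `O(log m)` bits — `O(ℓ log ℓ)` bits in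
all; instances with oracle gates (outside the promise) go to the fixed empty instance.
[cite: AaronsonAmbainis2018, §6 Thm. 25 ("polynomial-time reducible"; proof, p. 27)] -/
def AaronsonAmbainis2018_thm25_encodeFP : Prop :=
  ∃ f ∈ FP, ∀ I : QSimInstance, f I.encode = (thm25Instance I).encode

/-- **AA Theorem 25 from its residual `TM2` content.** If the instance map is polynomial-time
computable on codes, then QSIM Karp-reduces to explicit `k`-fold Forrelation
(`AaronsonAmbainis2018_thm25`): yes ↦ yes and no ↦ no by `isYes_thm25Instance`,
`isNo_thm25Instance`. [cite: AaronsonAmbainis2018, §6 Thm. 25] -/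
theorem AaronsonAmbainis2018_thm25_of_encodeFP (h : AaronsonAmbainis2018_thm25_encodeFP) :
    AaronsonAmbainis2018_thm25 := by
  obtain ⟨f, hf, hfI⟩ := h
  refine ⟨f, hf, ?_, ?_⟩
  · rintro w ⟨I, hI, rfl⟩
    rw [hfI]
    exact (encode_mem_kForrelationProblem_yes_iff _).2 (isYes_thm25Instance hI)
  · rintro w ⟨I, hI, rfl⟩
    rw [hfI]
    exact (encode_mem_kForrelationProblem_no_iff _).2 (isNo_thm25Instance hI)

/-- **The completeness fact from the three residual named facts.** Membership of explicit
`k`-fold Forrelation in `PromiseBQP` (AA p. 26 via Prop. 6), `PromiseBQP`-hardness of QSIM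
(Lemma 24, after Shi) and polynomial-time computability of the (here constructed and proved
correct) instance map of Theorem 25 give `aaronson_ambainis_kForrelation_complete`; transitivity
of Karp reductions of promise problems is the library's `PolyTimeReducible.trans_holds`
(`PromiseProofs.lean`). [cite: AaronsonAmbainis2018, §6 (Prop. 6, Lemma 24, Thm. 25)] -/
theorem aaronson_ambainis_kForrelation_complete_of_encodeFP
    (hmem : AaronsonAmbainis2018_kForrelation_mem) (h24 : AaronsonAmbainis2018_lemma24_hard)
    (h25 : AaronsonAmbainis2018_thm25_encodeFP) : aaronson_ambainis_kForrelation_complete :=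
  aaronson_ambainis_kForrelation_complete_of_steps hmem h24
    (AaronsonAmbainis2018_thm25_of_encodeFP h25) PromiseProblem.PolyTimeReducible.trans_holds

end Literature.Computability.QuantumComplexity

end
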